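import Summits.Langlands.Langlands.Theses.SteinbergArtinDedekind
import Literature.NumberTheory.Automorphic.CompletedCohomologyHeckeAlgebraGLn
import Literature.FieldTheory.AlgClosed.PadicAlgClEquivComplex

/-!
# Line `polarized-fern` — crux stmt-Langlands-11801 `SteinbergArtinDedekind.ArtinWeightLifting`
(route `route-Langlands-SteinbergArtinDedekind`, rank 2).  ALTERNATIVE line registered by the
crux-strategist `planner-cstrat-stmt-Langlands-11801-s1-0` (2026-08-17); it does NOT replace the live
skeleton `Lines/birth.lean`.  Card: `Lines/polarized-fern.md`; census: `STRATEGY-CENSUS.md`.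

## The cut (three stubs, k = 3)

Birth cuts the crux as (pro-automorphy of `σ` in the completed cohomology of `GL_ℓ/ℚ`) →
(Artin-weight classicality over `ℚ`).  Its first stub is the "big `R = 𝕋`" conjecture in POSITIVE
defect `l₀ = (ℓ−1)/2` (Calegari–Geraghty / Gee–Newton / Hansen Conj. 1.2.3), where not even the
Galois representation over `𝕋(K^ℓ)_𝔪` is known to exist.  This line moves the pro-automorphy step to
the POLARIZED world, where it has a theorem-sized core, and pays for it with a solvable CM base
change `F/ℚ` and an explicit descent stub:

* `stub_polarizedProAutomorphyCM` (PRO-AUTOMORPHY OVER A SOLVABLE CM FIELD).  `σ ≅ St ∘ ρ̄` is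
  orthogonal (a rational representation of `PGL₂(𝔽_ℓ)`), odd (`tr σ(c) = 1`) and extends to `Γ_ℚ`, so
  for every CM field `F = F⁺M` its restriction `r = ι⁻¹σ|_{Γ_F}` is POLARIZED
  (`r^{c,∨} ≅ r`, `μ` trivial) and `r̄ = Sym^{ℓ−1} ρ̄|_{Γ_F}` is absolutely irreducible with adequate
  image for `ℓ ≥ 5` in the extended sense of Guralnick–Herzig–Tiep (Cor. 9.4; `F ∩ ℚ(ρ̄) ⊆ ℚ(√ℓ*)`
  because `F/ℚ` is soluble and `PSL₂(𝔽_ℓ)` is simple).  The residual automorphic point can be taken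
  CRYSTALLINE at `ℓ`: `Π₀ = BC_{F/ℚ}(Sym^{ℓ−1} π_g)` with `g` of weight `k(ρ̄)` and level `N(ρ̄)` prime
  to `ℓ` (Khare–Wintenberger + Edixhoven; Newton–Thorne; Arthur–Clozel), which descends to the
  definite unitary group `U(ℓ)/F⁺` (Labesse).  CLAIM: for a suitable soluble CM `F` (every place of
  `S` split in `F/F⁺`, `F/F⁺` unramified, `ℓ` split in `M`) and an `S`-good tame level `𝒰` of
  `GL_ℓ/F`, `r` is `ℓ`-adically automorphic (`TameLevel.IsPadicallyAutomorphic`: associated with a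
  continuous `ℚ̄_ℓ`-point of the completed-cohomology Hecke algebra `𝕋(K^ℓ)` of `GL_ℓ/F`).
  MECHANISM (card §Stubs): (a) Hellmann–Margerin–Schraen 2022 Thm. 1.2 / 4.1 (`p > 2`, `S` split,
  adequate, a crystalline-at-`p` automorphic lift): the Zariski closure `𝒳^{aut}` of the automorphic
  points of the polarized deformation space `𝒳_{r̄,S}` is a union of irreducible components;
  (b) when the polarized problem is UNOBSTRUCTED (`Hom_{Γ_{F_w}}(r̄, r̄(1)) = 0` for `w ∈ S` — true at
  `w ∣ ℓ` in the niveau-2 regime, a checkable condition at `w ∣ N(ρ̄)` — and `Ш¹_S(ad r̄(1)) = 0`)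
  `R^{pol}_S` is a power-series ring, so `𝒳_{r̄,S}` is irreducible and `𝒳^{aut} = 𝒳_{r̄,S} ∋ x_σ`;
  (c) `x_σ ∈ 𝒳^{aut}` says that `λ_σ` kills `ker(𝕋^S → 𝕋^{big}(U(ℓ))_𝔪)`, i.e. `σ` is a continuous
  point of the big Hecke algebra of the DEFINITE unitary group (defect `l₀ = 0`); (d) `ℓ`-adic base
  change of big Hecke algebras `U(ℓ)/F⁺ ⇝ GL_ℓ/F` (Labesse on the Zariski-dense classical points,
  reducedness of `𝕋^{big}(U(ℓ))`, occurrence of cuspidal cohomological `BC(π)` in `H^•(X_K, ℂ)`).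
  Open residue: the obstructed cases (there one needs an automorphic point on THE component of
  `x_σ`: Allen 2019 Thm. 32 needs `p ∤ 2n` and potential diagonalisability, Thm. 33 the ordinary
  regime) and the adequacy convention at `p = n` inside HMS/BHS (stated with Thorne-2012 adequacy,
  which presupposes `p ∤ n`; expected to go through with GHT adequacy via Thorne's 2-adic Prop. 7.1,
  exactly as Allen 2019 §5.1 does for Thorne's Thm. 10.1 — not in print).  Size: XL (conjecture
  with a theorem core = Chenevier's density Conjecture 1.1 at the Artin point of `Sym^{ℓ−1}ρ̄|_{Γ_F}`).
* `stub_artinPointClassicalityCM` (ARTIN-WEIGHT CLASSICALITY OVER `F`).  If `r = ι⁻¹σ|_{Γ_F}` is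
  `ℓ`-adically automorphic on `GL_ℓ/F` (`F/ℚ` soluble Galois CM), then `σ|_{Γ_F}` is automorphic:
  a cuspidal `Π` on `GL_ℓ(𝔸_F)` with a.e. Satake–Frobenius matching.  OPEN, template-free in rank
  `≥ 3` on every host (census §K-root: the automorphic representation to be produced has
  infinitesimal character `0^ℓ`, invisible to Betti AND coherent cohomology of every Shimura
  variety / locally symmetric space as soon as the maximal compact has a root — this is where
  `Literature.Barriers.Langlands.NonRegularWeightBarrier` lives, isolated).  The polarized host at
  least supplies the objects a Sen-theoretic attack needs: the admissible unitary Banach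
  representation `Π_σ = Ĥ⁰(U(ℓ), K^p)[λ_σ]` of `GL_ℓ(ℚ_ℓ)` (functions on a profinite set; no smooth
  and no locally algebraic vectors; locally analytic vectors of the SINGULAR infinitesimal character
  by Dospinescu–Paškūnas–Schraen, definite unitary case), and `H¹_f(F, ad σ) = 0` (finiteness of the
  class group: the Artin point is infinitesimally rigid among de Rham deformations).
* `stub_artinTypeSolvableDescent` (SOLUBLE DESCENT FOR ARTIN-TYPE CUSPIDAL REPRESENTATIONS).  If
  `σ|_{Γ_F}` is cuspidal automorphic on `GL_ℓ/F` for a soluble Galois `F/ℚ`, then `σ` is cuspidal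
  automorphic on `GL_ℓ/ℚ` (a.e. matching).  Arthur–Clozel cyclic descent along a composition series
  gives, at each prime layer `E/E'`, a descent unique up to the characters of `Gal(E/E')`; pinning
  the twist and the matching at the INERT places needs either Galois representations attached to
  the (non-regular!) descended representation or an `L`-function substitute — known for `n = 2`
  (weight one: Deligne–Serre), OPEN for Artin type in rank `≥ 3` (cf. the tree's own note on
  `CriticalCocycle.SolvableDescent`, stmt-Langlands-3700).  Size: L.

Composition `ArtinWeightLifting_of`: choose `ι : ℚ̄_ℓ ≃ ℂ` (`PadicAlgCl.nonempty_ringEquiv_complex`,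
proved), stub 1 gives `(F, 𝒰, r)`, stub 2 gives `Π` over `F`, stub 3 descends to `ℚ` — pure logic,
sorry-free; the hypothetical form is kept as an `example`.

Neither stub is the crux or the summit in costume: stub 1 concludes `ℓ`-adic automorphy over a CM
field (not implied by `Langlands`), stub 2 assumes it, stub 3 assumes automorphy over `F`; the
probes `stub → ArtinWeightLifting` / `stub → Langlands` by `first | exact? | simpa | aesop` fail
(folder `bc/`, NOTES.md).  Disproof used: none (no `Disproof.lean` on this crux).  Dead lines: none
recorded.  Barriers: `NonRegularWeightBarrier` isolated in stub 2; `SolvableImageBarrier` honoured —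
the only descent asked for is along the SOLUBLE `F/ℚ` (stub 3), never along `ℚ(ρ̄)/ℚ`;
`PatchingLocalComponentBarrier` is what the unobstructedness clause of stub 1 evades (one component);
`TaylorWilesNumericalCoincidence` is why the host is `U(ℓ)` (narrowed barrier: polarized odd `r` of
any dimension is not blocked).

Leans on (by name): `Summit.Langlands.Langlands.Theses.SteinbergArtinDedekind.ArtinWeightLifting`,
`Literature.NumberTheory.Automorphic.BigHeckeGLn.TameLevel`, `…TameLevel.IsPadicallyAutomorphic`,
`Literature.NumberTheory.GaloisRepresentations.FramedGaloisRep.restrictField`,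
`PadicAlgCl.nonempty_ringEquiv_complex` (proved), `FramedGaloisRep.IsUnramifiedAt/HasFrobCharpolyAt`,
`CuspidalAutomorphicRepData`, `AutomorphicRepData.HasSatakeParamAt`, `satakePolynomial`,
Mathlib `IsGalois`, `IsSolvable`, `NumberField.IsTotallyComplex`.
-/

noncomputable section

open scoped BigOperators Topology Classical Matrix
open scoped MatrixGroups NumberField Polynomial
open Filter Set Function
open Literature.NumberTheory.Automorphic Literature.NumberTheory.GaloisRepresentations
open Literature.NumberTheory.Automorphic.BigHeckeGLn

-- `Summit.Langlands.Langlands.…`: summit = sub-problem name (D-0017 nested layout), not a typo.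
set_option linter.dupNamespace false

namespace Summit.Langlands.Langlands.Cruxes.ArtinWeightLifting.PolarizedFern

/-- **STUB 1 — `PolarizedProAutomorphyCM`.**  Under the hypotheses of the crux (`ℓ ≥ 5`, `ρ̄`
surjective odd, `σ` Steinberg-of-`ρ̄`, `σ` congruent mod `𝔩 ∣ ℓ` to a weight-zero cuspidal `Π` on
`GL_ℓ/ℚ`), for every `ι : ℚ̄_ℓ ≃ ℂ` there are a SOLUBLE GALOIS CM number field `F/ℚ`, an `S`-good tame
level `𝒰` of `GL_ℓ/F` at `p = ℓ` and the entrywise `ℓ`-adic avatar `r` of `σ|_{Γ_F}` along `ι` such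
that `r` is `ℓ`-adically automorphic of tame level `𝒰`.  Polarized route to it: HMS 2022 Thm. 1.2 on
the definite unitary group `U(ℓ)/F⁺` + unobstructedness of the polarized deformation problem of
`Sym^{ℓ−1}ρ̄|_{Γ_F}` + `ℓ`-adic base change of big Hecke algebras (module docstring).
[cite: HellmannMargerinSchraen2022, Thm. 1.2 and Thm. 4.1] [cite: Allen2019, Thm. 32–33]
[cite: GuralnickHerzigTiep2017, Cor. 9.4] — conjecture-grade in general (Chenevier's density
conjecture at the Artin point), theorem-cored in the unobstructed niveau-2 sub-family. -/
theorem stub_polarizedProAutomorphyCM :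
    ∀ (ℓ : ℕ) [Fact ℓ.Prime], 5 ≤ ℓ → ∀ (ρ : Literature.NumberTheory.GaloisRepresentations.FramedGaloisRep ℚ (ZMod ℓ) 2) (σ : Literature.NumberTheory.GaloisRepresentations.FramedGaloisRep ℚ ℂ ℓ), Function.Surjective ρ → ρ.IsOdd → (∀ g, ((σ g : Matrix (Fin ℓ) (Fin ℓ) ℂ)).trace = ((Nat.card {w : Fin 2 → ZMod ℓ // w ≠ 0 ∧ ∃ a : ZMod ℓ, ((ρ g : Matrix (Fin 2) (Fin 2) (ZMod ℓ))).mulVec w = a • w} : ℂ)) / ((ℓ : ℂ) - 1) - 1) → (∃ (hcpt' : Literature.NumberTheory.Automorphic.isCompact_glFiniteIntegralLevel ℓ ℚ) (piR : Literature.NumberTheory.Automorphic.CuspidalAutomorphicRepData ℓ ℚ hcpt'), piR.1.HasWeightZero ∧ ∃ 𝔩 : Ideal ↥(integralClosure ℤ ℂ), 𝔩.IsMaximal ∧ ((ℓ : ℕ) : ↥(integralClosure ℤ ℂ)) ∈ 𝔩 ∧ ∀ᶠ v : IsDedekindDomain.HeightOneSpectrum (NumberField.RingOfIntegers ℚ)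 in Filter.cofinite, ∃ (P : Polynomial ↥(integralClosure ℤ ℂ)) (Q : Polynomial ℤ), piR.1.HasHeckePolynomialAt v (P.map (algebraMap ↥(integralClosure ℤ ℂ) ℂ)) ∧ σ.IsUnramifiedAt v ∧ σ.HasFrobCharpolyAt v (Q.map (Int.castRingHom ℂ)) ∧ P.map (Ideal.Quotient.mk 𝔩) = (Q.map (Int.castRingHom ↥(integralClosure ℤ ℂ))).map (Ideal.Quotient.mk 𝔩)) →
      ∀ ι : PadicAlgCl ℓ ≃+* ℂ,
        ∃ (F : Type) (_ : Field F) (_ : NumberField F) (_ : IsGalois ℚ F) (_ : IsSolvable (F ≃ₐ[ℚ] F))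
          (𝒰 : Literature.NumberTheory.Automorphic.BigHeckeGLn.TameLevel ℓ F ℓ)
          (r : Literature.NumberTheory.GaloisRepresentations.FramedGaloisRep F (PadicAlgCl ℓ) ℓ),
          NumberField.IsTotallyComplex F ∧
          (∀ g, (((r g : GL (Fin ℓ) (PadicAlgCl ℓ)) : Matrix (Fin ℓ) (Fin ℓ) (PadicAlgCl ℓ))).map ι =
            (((σ.restrictField F) g : GL (Fin ℓ) ℂ) : Matrix (Fin ℓ) (Fin ℓ) ℂ)) ∧
          𝒰.IsPadicallyAutomorphic r := by
  sorry

/-- **STUB 2 — `ArtinPointClassicalityCM` (Artin-type points of `𝕋(K^ℓ)` of `GL_ℓ` over a soluble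
CM field are classical).**  For `ℓ ≥ 5`, `ρ̄` surjective odd, `σ` Steinberg-of-`ρ̄`, a soluble Galois
totally complex number field `F/ℚ` (so `σ|_{Γ_F} ⊇ St(PSL₂(𝔽_ℓ))` stays irreducible), an `S`-good
tame level `𝒰` of `GL_ℓ/F` and the entrywise avatar `r` of `σ|_{Γ_F}` along `ι`: if `r` is
`ℓ`-adically automorphic of tame level `𝒰`, then `σ|_{Γ_F}` is cuspidal automorphic on `GL_ℓ(𝔸_F)`
(a.e. Satake–Frobenius matching).  The Artin-weight classicality step, posed where the polarized
host `U(ℓ)/F⁺` supplies `Π_σ = Ĥ⁰[λ_σ]` (no smooth, no locally algebraic vectors; locally analytic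
vectors of singular infinitesimal character `0^ℓ`, Dospinescu–Paškūnas–Schraen) and where
`H¹_f(F, ad σ) = 0`.  OPEN — template-free in rank `≥ 3`
(`Literature.Barriers.Langlands.NonRegularWeightBarrier` lives here).
[cite: CalegariGeraghty2017, §1] [cite: arXiv:2605.03519] -/
theorem stub_artinPointClassicalityCM :
    ∀ (ℓ : ℕ) [Fact ℓ.Prime], 5 ≤ ℓ → ∀ (ρ : Literature.NumberTheory.GaloisRepresentations.FramedGaloisRep ℚ (ZMod ℓ) 2) (σ : Literature.NumberTheory.GaloisRepresentations.FramedGaloisRep ℚ ℂ ℓ), Function.Surjective ρ → ρ.IsOdd → (∀ g, ((σ g : Matrix (Fin ℓ) (Fin ℓ) ℂ)).trace = ((Nat.card {w : Fin 2 → ZMod ℓ // w ≠ 0 ∧ ∃ a : ZMod ℓ, ((ρ g : Matrix (Fin 2) (Fin 2) (ZMod ℓ))).mulVec w = a • w} : ℂ)) / ((ℓ : ℂ) - 1) - 1) →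
      ∀ (ι : PadicAlgCl ℓ ≃+* ℂ) (F : Type) [Field F] [NumberField F] [IsGalois ℚ F] [IsSolvable (F ≃ₐ[ℚ] F)]
        (𝒰 : Literature.NumberTheory.Automorphic.BigHeckeGLn.TameLevel ℓ F ℓ)
        (r : Literature.NumberTheory.GaloisRepresentations.FramedGaloisRep F (PadicAlgCl ℓ) ℓ),
        NumberField.IsTotallyComplex F →
        (∀ g, (((r g : GL (Fin ℓ) (PadicAlgCl ℓ)) : Matrix (Fin ℓ) (Fin ℓ) (PadicAlgCl ℓ))).map ι =
          (((σ.restrictField F) g : GL (Fin ℓ) ℂ) : Matrix (Fin ℓ) (Fin ℓ) ℂ)) →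
        𝒰.IsPadicallyAutomorphic r →
        ∃ (hcptF : Literature.NumberTheory.Automorphic.isCompact_glFiniteIntegralLevel ℓ F)
          (PiF : Literature.NumberTheory.Automorphic.CuspidalAutomorphicRepData ℓ F hcptF),
          ∀ᶠ w : IsDedekindDomain.HeightOneSpectrum (NumberField.RingOfIntegers F) in Filter.cofinite,
            ∃ α : Multiset ℂ, PiF.1.HasSatakeParamAt w α ∧ (σ.restrictField F).IsUnramifiedAt w ∧
              (σ.restrictField F).HasFrobCharpolyAt w (Literature.NumberTheory.Automorphic.satakePolynomial α) := by
  sorry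

/-- **STUB 3 — `ArtinTypeSolvableDescent` (soluble descent for the Steinberg–Artin family).**  For
`ℓ ≥ 5`, `ρ̄` surjective odd, `σ` Steinberg-of-`ρ̄`, and a soluble Galois number field `F/ℚ`: if
`σ|_{Γ_F}` matches a cuspidal `Π` on `GL_ℓ(𝔸_F)` at almost all places, then `σ` matches a cuspidal
`π` on `GL_ℓ(𝔸_ℚ)` at almost all places (verbatim the crux conclusion).  Cyclic layers: Arthur–Clozel
descent (Ch. 3 Thm. 6.2, Lemma 6.4) up to a twist by `Gal(E/E')^∨`; the twist and the matching at
INERT places are the open content for Artin-type (non-regular) `Π` in rank `≥ 3`, which carry no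
Galois representation — for `n = 2` weight one this is Deligne–Serre.
[cite: ArthurClozelAMS120, Ch. 3 Thm. 6.2 and Lemma 6.4] [cite: BuzzardGeeLMS2014, §3.1] -/
theorem stub_artinTypeSolvableDescent :
    ∀ (ℓ : ℕ) [Fact ℓ.Prime], 5 ≤ ℓ → ∀ (ρ : Literature.NumberTheory.GaloisRepresentations.FramedGaloisRep ℚ (ZMod ℓ) 2) (σ : Literature.NumberTheory.GaloisRepresentations.FramedGaloisRep ℚ ℂ ℓ), Function.Surjective ρ → ρ.IsOdd → (∀ g, ((σ g : Matrix (Fin ℓ) (Fin ℓ) ℂ)).trace = ((Nat.card {w : Fin 2 → ZMod ℓ // w ≠ 0 ∧ ∃ a : ZMod ℓ, ((ρ g : Matrix (Fin 2) (Fin 2) (ZMod ℓ))).mulVec w = a • w} : ℂ)) / ((ℓ : ℂ) - 1) - 1) →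
      ∀ (F : Type) [Field F] [NumberField F] [IsGalois ℚ F] [IsSolvable (F ≃ₐ[ℚ] F)],
        (∃ (hcptF : Literature.NumberTheory.Automorphic.isCompact_glFiniteIntegralLevel ℓ F)
          (PiF : Literature.NumberTheory.Automorphic.CuspidalAutomorphicRepData ℓ F hcptF),
          ∀ᶠ w : IsDedekindDomain.HeightOneSpectrum (NumberField.RingOfIntegers F) in Filter.cofinite,
            ∃ α : Multiset ℂ, PiF.1.HasSatakeParamAt w α ∧ (σ.restrictField F).IsUnramifiedAt w ∧
              (σ.restrictField F).HasFrobCharpolyAt w (Literature.NumberTheory.Automorphic.satakePolynomial α)) →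
        ∃ (hcpt : Literature.NumberTheory.Automorphic.isCompact_glFiniteIntegralLevel ℓ ℚ)
          (π : Literature.NumberTheory.Automorphic.CuspidalAutomorphicRepData ℓ ℚ hcpt),
          ∀ᶠ v : IsDedekindDomain.HeightOneSpectrum (NumberField.RingOfIntegers ℚ) in Filter.cofinite,
            ∃ α : Multiset ℂ, π.1.HasSatakeParamAt v α ∧ σ.IsUnramifiedAt v ∧
              σ.HasFrobCharpolyAt v (Literature.NumberTheory.Automorphic.satakePolynomial α) := by
  sorry

/-- **The crux BY NAME from the three stubs** (registered skeleton theorem: no hypotheses, the stubs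
used by name): choose `ι : ℚ̄_ℓ ≃+* ℂ` (`PadicAlgCl.nonempty_ringEquiv_complex`, proved); stub 1 gives a
soluble CM `F`, a tame level and the `ℓ`-adically automorphic avatar of `σ|_{Γ_F}`; stub 2 makes
`σ|_{Γ_F}` automorphic on `GL_ℓ/F`; stub 3 descends to `ℚ`. [folklore] -/
theorem ArtinWeightLifting_of :
    Summit.Langlands.Langlands.Theses.SteinbergArtinDedekind.ArtinWeightLifting := by
  intro ℓ _ hℓ ρ σ hsurj hodd hchar hcong
  obtain ⟨ι⟩ := PadicAlgCl.nonempty_ringEquiv_complex ℓ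
  obtain ⟨F, _, _, _, _, 𝒰, r, hF, hr, hpa⟩ :=
    stub_polarizedProAutomorphyCM ℓ hℓ ρ σ hsurj hodd hchar hcong ι
  have hPi := stub_artinPointClassicalityCM ℓ hℓ ρ σ hsurj hodd hchar ι F 𝒰 r hF hr hpa
  exact stub_artinTypeSolvableDescent ℓ hℓ ρ σ hsurj hodd hchar F hPi

/-- **The same composition as PURE LOGIC, hypothetical form**
`<stub₁-sig> → <stub₂-sig> → <stub₃-sig> → ArtinWeightLifting` (sorry-free, axiom-clean; an `example`
so that the skeleton audit sees exactly one theorem concluding the crux). [folklore] -/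
example
    (h1 : ∀ (ℓ : ℕ) [Fact ℓ.Prime], 5 ≤ ℓ → ∀ (ρ : Literature.NumberTheory.GaloisRepresentations.FramedGaloisRep ℚ (ZMod ℓ) 2) (σ : Literature.NumberTheory.GaloisRepresentations.FramedGaloisRep ℚ ℂ ℓ), Function.Surjective ρ → ρ.IsOdd → (∀ g, ((σ g : Matrix (Fin ℓ) (Fin ℓ) ℂ)).trace = ((Nat.card {w : Fin 2 → ZMod ℓ // w ≠ 0 ∧ ∃ a : ZMod ℓ, ((ρ g : Matrix (Fin 2) (Fin 2) (ZMod ℓ))).mulVec w = a • w} : ℂ)) / ((ℓ : ℂ) - 1) - 1) → (∃ (hcpt' : Literature.NumberTheory.Automorphic.isCompact_glFiniteIntegralLevel ℓ ℚ) (piR : Literature.NumberTheory.Automorphic.CuspidalAutomorphicRepData ℓ ℚ hcpt'), piR.1.HasWeightZero ∧ ∃ 𝔩 : Ideal ↥(integralClosure ℤ ℂ), 𝔩.IsMaximal ∧ ((ℓ : ℕ) : ↥(integralClosure ℤ ℂ)) ∈ 𝔩 ∧ ∀ᶠ v : IsDedekindDomain.HeightOneSpectrum (NumberField.RingOfIntegers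 ℚ) in Filter.cofinite, ∃ (P : Polynomial ↥(integralClosure ℤ ℂ)) (Q : Polynomial ℤ), piR.1.HasHeckePolynomialAt v (P.map (algebraMap ↥(integralClosure ℤ ℂ) ℂ)) ∧ σ.IsUnramifiedAt v ∧ σ.HasFrobCharpolyAt v (Q.map (Int.castRingHom ℂ)) ∧ P.map (Ideal.Quotient.mk 𝔩) = (Q.map (Int.castRingHom ↥(integralClosure ℤ ℂ))).map (Ideal.Quotient.mk 𝔩)) →
      ∀ ι : PadicAlgCl ℓ ≃+* ℂ,
        ∃ (F : Type) (_ : Field F) (_ : NumberField F) (_ : IsGalois ℚ F) (_ : IsSolvable (F ≃ₐ[ℚ] F))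
          (𝒰 : Literature.NumberTheory.Automorphic.BigHeckeGLn.TameLevel ℓ F ℓ)
          (r : Literature.NumberTheory.GaloisRepresentations.FramedGaloisRep F (PadicAlgCl ℓ) ℓ),
          NumberField.IsTotallyComplex F ∧
          (∀ g, (((r g : GL (Fin ℓ) (PadicAlgCl ℓ)) : Matrix (Fin ℓ) (Fin ℓ) (PadicAlgCl ℓ))).map ι =
            (((σ.restrictField F) g : GL (Fin ℓ) ℂ) : Matrix (Fin ℓ) (Fin ℓ) ℂ)) ∧
          𝒰.IsPadicallyAutomorphic r)
    (h2 : ∀ (ℓ : ℕ) [Fact ℓ.Prime], 5 ≤ ℓ → ∀ (ρ : Literature.NumberTheory.GaloisRepresentations.FramedGaloisRep ℚ (ZMod ℓ) 2) (σ : Literature.NumberTheory.GaloisRepresentations.FramedGaloisRep ℚ ℂ ℓ), Function.Surjective ρ → ρ.IsOdd → (∀ g, ((σ g : Matrix (Fin ℓ) (Fin ℓ) ℂ)).trace = ((Nat.card {w : Fin 2 → ZMod ℓ // w ≠ 0 ∧ ∃ a : ZMod ℓ, ((ρ g : Matrix (Fin 2) (Fin 2) (ZMod ℓ))).mulVec w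 = a • w} : ℂ)) / ((ℓ : ℂ) - 1) - 1) →
      ∀ (ι : PadicAlgCl ℓ ≃+* ℂ) (F : Type) [Field F] [NumberField F] [IsGalois ℚ F] [IsSolvable (F ≃ₐ[ℚ] F)]
        (𝒰 : Literature.NumberTheory.Automorphic.BigHeckeGLn.TameLevel ℓ F ℓ)
        (r : Literature.NumberTheory.GaloisRepresentations.FramedGaloisRep F (PadicAlgCl ℓ) ℓ),
        NumberField.IsTotallyComplex F →
        (∀ g, (((r g : GL (Fin ℓ) (PadicAlgCl ℓ)) : Matrix (Fin ℓ) (Fin ℓ) (PadicAlgCl ℓ))).map ι =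
          (((σ.restrictField F) g : GL (Fin ℓ) ℂ) : Matrix (Fin ℓ) (Fin ℓ) ℂ)) →
        𝒰.IsPadicallyAutomorphic r →
        ∃ (hcptF : Literature.NumberTheory.Automorphic.isCompact_glFiniteIntegralLevel ℓ F)
          (PiF : Literature.NumberTheory.Automorphic.CuspidalAutomorphicRepData ℓ F hcptF),
          ∀ᶠ w : IsDedekindDomain.HeightOneSpectrum (NumberField.RingOfIntegers F) in Filter.cofinite,
            ∃ α : Multiset ℂ, PiF.1.HasSatakeParamAt w α ∧ (σ.restrictField F).IsUnramifiedAt w ∧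
              (σ.restrictField F).HasFrobCharpolyAt w (Literature.NumberTheory.Automorphic.satakePolynomial α))
    (h3 : ∀ (ℓ : ℕ) [Fact ℓ.Prime], 5 ≤ ℓ → ∀ (ρ : Literature.NumberTheory.GaloisRepresentations.FramedGaloisRep ℚ (ZMod ℓ) 2) (σ : Literature.NumberTheory.GaloisRepresentations.FramedGaloisRep ℚ ℂ ℓ), Function.Surjective ρ → ρ.IsOdd → (∀ g, ((σ g : Matrix (Fin ℓ) (Fin ℓ) ℂ)).trace = ((Nat.card {w : Fin 2 → ZMod ℓ // w ≠ 0 ∧ ∃ a : ZMod ℓ, ((ρ g : Matrix (Fin 2) (Fin 2) (ZMod ℓ))).mulVec w = a • w} : ℂ)) / ((ℓ : ℂ) - 1) - 1) →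
      ∀ (F : Type) [Field F] [NumberField F] [IsGalois ℚ F] [IsSolvable (F ≃ₐ[ℚ] F)],
        (∃ (hcptF : Literature.NumberTheory.Automorphic.isCompact_glFiniteIntegralLevel ℓ F)
          (PiF : Literature.NumberTheory.Automorphic.CuspidalAutomorphicRepData ℓ F hcptF),
          ∀ᶠ w : IsDedekindDomain.HeightOneSpectrum (NumberField.RingOfIntegers F) in Filter.cofinite,
            ∃ α : Multiset ℂ, PiF.1.HasSatakeParamAt w α ∧ (σ.restrictField F).IsUnramifiedAt w ∧
              (σ.restrictField F).HasFrobCharpolyAt w (Literature.NumberTheory.Automorphic.satakePolynomial α)) →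
        ∃ (hcpt : Literature.NumberTheory.Automorphic.isCompact_glFiniteIntegralLevel ℓ ℚ)
          (π : Literature.NumberTheory.Automorphic.CuspidalAutomorphicRepData ℓ ℚ hcpt),
          ∀ᶠ v : IsDedekindDomain.HeightOneSpectrum (NumberField.RingOfIntegers ℚ) in Filter.cofinite,
            ∃ α : Multiset ℂ, π.1.HasSatakeParamAt v α ∧ σ.IsUnramifiedAt v ∧
              σ.HasFrobCharpolyAt v (Literature.NumberTheory.Automorphic.satakePolynomial α)) :
    Summit.Langlands.Langlands.Theses.SteinbergArtinDedekind.ArtinWeightLifting := by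
  intro ℓ _ hℓ ρ σ hsurj hodd hchar hcong
  obtain ⟨ι⟩ := PadicAlgCl.nonempty_ringEquiv_complex ℓ
  obtain ⟨F, _, _, _, _, 𝒰, r, hF, hr, hpa⟩ := h1 ℓ hℓ ρ σ hsurj hodd hchar hcong ι
  have hPi := h2 ℓ hℓ ρ σ hsurj hodd hchar ι F 𝒰 r hF hr hpa
  exact h3 ℓ hℓ ρ σ hsurj hodd hchar F hPi

end Summit.Langlands.Langlands.Cruxes.ArtinWeightLifting.PolarizedFern

end
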